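import Literature.MathematicalPhysics.QuantumManyBody.LangevinGenerator
import Literature.MathematicalPhysics.QuantumManyBody.PeriodicFeynmanKacCell
import Mathlib.MeasureTheory.Measure.OpenPos
import HarnessLib

/-!
# Resolvent (massive) correctors for the weighted Dirichlet form on the `N`-particle torus

Topic `Literature/MathematicalPhysics/QuantumManyBody` (definition item `defn-IsResolventCorrector`,
wanted by the crux line `insertion-mode-gaussian-domination` of route `BECInsertionCorrector`, crux
`CorrectorClosure`). Sequel of `WeightedCorrector.lean` (same namespace, same vocabulary:
`IsPeriodicTest`, `dirichletFormW = 𝓔_F`, `hMinusOneSqW = ‖·‖²₋₁`, `IsWeakCorrector`), kept in a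
leaf file because the parent is already long.

**Setting.** As in `WeightedCorrector.lean`: `N` particles on the torus `(ℝ³/Lℤ³)^N`, fundamental
cell `cellN N L = [0,L)^{3N}`, a weight `F : Config N → ℝ` (symmetrising measure `F² dX`), the
Dirichlet form `𝓔_F(φ, ψ) = ∫ ∇φ·∇ψ F² dX` of the diffusion with generator
`L_F = Δ + 2∇(log F)·∇`, and the pairing `⟨u, v⟩ = ∫_{[0,L)^{3N}} u v F² dX`.

* `IsResolventCorrector L F m g χ` — `χ` is a periodic test function solving the **resolvent
  equation** `(m - L_F) χ = g` weakly on the torus: `𝓔_F(χ, φ) + m ⟨χ, φ⟩ = ⟨g, φ⟩` for every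
  periodic test function `φ`. This is Kipnis–Landim's `γ f_γ - L f_γ = g`
  [KipnisLandim1999, App. 1 §6, proof of Prop. 6.1] at `γ = m` for the `F² dX`-symmetric
  diffusion, tested on the `C¹` periodic core exactly as `IsWeakCorrector` (the case `m = 0`,
  `isResolventCorrector_zero_iff`). For `m = |p|²`, `p = 2πn/L`, it is the recoil-regularised
  corrector `χ = (-L_F + p²)⁻¹ g` of an insertion mode.

API (all proved):
* bookkeeping: the equation, the energy identity `𝓔_F(χ,χ) + m ∫ χ² F² = ∫ g χ F²` (test `φ = χ`),
  centring `m ∫ χ F² = ∫ g F²` (test `φ = 1`), `zero`, `const` (constants: `(m - L_F) c = m c`),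
  linearity `smul`/`neg`/`add`/`sub`, invariance under rescaling the weight, and the reading
  `-L_F χ = g - m χ` (`isWeakCorrector_sub`);
* **uniqueness** for `L > 0`, a continuous non-vanishing weight and `m > 0` (`unique`: the
  difference solves the homogeneous equation; tested against itself it has `∫ δ² F² = 0` on the
  cell, so `δ = 0` a.e. on the cell, a.e. on `(ℝ³)^N` by periodicity, everywhere by continuity);
* the **`H₋₁` identity** `‖g‖²₋₁ = m² ‖χ‖²₋₁ + 2m ∫ χ² F² + 𝓔_F(χ, χ)` (`hMinusOneSqW_source_eq`,
  the `m > 0` companion of Kipnis–Landim's `‖S f‖²₋₁ = ‖f‖₁²`; spectrally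
  `⟨g, (-L)⁻¹ g⟩ = ⟨χ, (m - L)² (-L)⁻¹ χ⟩`), proved variationally on the core: the `H₋₁` functional
  of `g` at `ψ = m φ + χ` equals `m² (2⟨χ, φ⟩ - 𝓔_F(φ, φ)) + 𝓔_F(χ, χ) + 2m⟨χ, χ⟩` (the cross terms
  cancel by symmetry of `𝓔_F`), and `φ ↦ m φ + χ` is a bijection of the core for `m ≠ 0`;
* its corollaries: the **resolvent contraction in `H₋₁`**, `‖χ‖²₋₁ ≤ m⁻² ‖g‖²₋₁`
  (`hMinusOneSqW_le`; spectrally `∫ dμ_g(ω)/(ω (ω + m)²) ≤ m⁻² ∫ dμ_g(ω)/ω`), Kipnis–Landim's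
  estimates (6.3) `m ⟨f_m, f_m⟩ ≤ ‖g‖²₋₁` (here with `2m`) and `‖f_m‖₁² = 𝓔_F(χ, χ) ≤ ‖g‖²₋₁`, and
  their real-valued forms under a bound `‖g‖²₋₁ ≤ C` (the Kipnis–Varadhan bound
  `(∫ χ φ F²)² ≤ (C/m²) 𝓔_F(φ, φ)`);
* the **strong form** (vocabulary of `LangevinGenerator.lean`, `langevinGen F = L_F`): a `C²`
  lattice-periodic classical solution of `-L_F χ + m χ = g` is a resolvent corrector
  (`of_langevinGen`, Green's identity), and a resolvent corrector with smooth data (`F ∈ C²`,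
  `χ ∈ C³`, `g ∈ C¹`) solves `-L_F χ + m χ = g` everywhere (`neg_langevinGen_add_eq`).

## Design choices

* The definition is the literal `m`-shift of `IsWeakCorrector`: same binders, same pairing
  `∫_{cellN} u φ F²`, `m` a real parameter (no sign imposed; the estimates assume `m > 0`, the
  regime of the resolvent of the non-negative operator `-L_F`). As there, no operator, semigroup
  or resolvent is constructed and no junk value arises (an equation between real integrals).
* Deliberately not here: EXISTENCE of resolvent correctors. For `L > 0`, `m > 0`, `F ∈ C¹`
  periodic and positive and `g` continuous periodic, a unique weak solution exists in the weighted
  Sobolev space `H¹(F² dX)` of the torus by the Lax–Milgram lemma (the form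
  `𝓔_F + m⟨·,·⟩_{F²}` is coercive), and it is `C^{1,α}` — hence a periodic test function — by
  elliptic regularity for `div(F²∇χ) = F²(mχ - g)` (`W^{2,2}`, then `W^{2,p}` for all `p` by the
  Calderón–Zygmund bootstrap, then Morrey); Mathlib has Lax–Milgram but neither Sobolev spaces on
  the torus nor elliptic regularity, so this is left to a separate named fact when a route item
  needs it.
* Additivity lemmas for `𝓔_F` and the pairing (continuous weight, `C¹` test functions) are proved
  here because the `H₋₁` identity expands `𝓔_F(mφ + χ, mφ + χ)`; `WeightedCorrector.lean` only
  had the polarisation of a difference (`gradDot_add_left` is `LangevinGenerator.lean`'s).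
* The lattice reduction `cellProj` / `ae_eq_of_periodic_of_ae_eq_cellN` of
  `PeriodicFeynmanKacCell.lean` is imported to state uniqueness and the strong form on all of
  `(ℝ³)^N` rather than on the fundamental cell only.

## References

* [KipnisLandim1999] C. Kipnis, C. Landim, *Scaling Limits of Interacting Particle Systems*,
  Grundlehren 320, Springer 1999: Appendix 1, §6, (6.1)–(6.3) and the proof of Proposition 6.1
  (the resolvent equation `γ f_γ - L f_γ = g` and the estimates
  `γ⟨f_γ, f_γ⟩_π ≤ ‖g‖²₋₁`, `‖f_γ‖₁² ≤ ‖g‖²₋₁`).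
* [KipnisVaradhan1986] C. Kipnis, S. R. S. Varadhan, Comm. Math. Phys. 104 (1986) 1–19: §1, the
  resolvent equation `(λ - L) u_λ = V`, condition (1.14).
* [BakryGentilLedoux2014] D. Bakry, I. Gentil, M. Ledoux, *Analysis and Geometry of Markov
  Diffusion Operators*, Springer 2014: §1.11.3 (1.11.9) (Green's identity for `L_F`).
-/

noncomputable section

open MeasureTheory
open scoped ENNReal NNReal

namespace Literature.MathematicalPhysics.QuantumManyBody.BoseGas

variable {N : ℕ}

/-! ### Additivity of the Dirichlet form and of the pairing -/

section Bilinear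

variable {L : ℝ} {F g g₁ g₂ φ ψ φ₁ φ₂ ψ₁ ψ₂ : Config N → ℝ}

/-- **Additivity of the Dirichlet form** in the first slot,
`𝓔_F(φ₁ + φ₂, ψ) = 𝓔_F(φ₁, ψ) + 𝓔_F(φ₂, ψ)`, for periodic test functions and a continuous weight
(integrability on the bounded cell). [folklore] -/
theorem dirichletFormW_add_left (hF : Continuous F) (hφ₁ : IsPeriodicTest L φ₁)
    (hφ₂ : IsPeriodicTest L φ₂) (hψ : IsPeriodicTest L ψ) :
    dirichletFormW L F (φ₁ + φ₂) ψ = dirichletFormW L F φ₁ ψ + dirichletFormW L F φ₂ ψ := by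
  unfold dirichletFormW
  rw [← integral_add (integrableOn_gradDot_mul_sq hF hφ₁.1 hψ.1 L)
    (integrableOn_gradDot_mul_sq hF hφ₂.1 hψ.1 L)]
  congr 1 with X
  rw [gradDot_add_left (hφ₁.differentiable X) (hφ₂.differentiable X), add_mul]

/-- Additivity of the Dirichlet form in the second slot. [folklore] -/
theorem dirichletFormW_add_right (hF : Continuous F) (hφ : IsPeriodicTest L φ)
    (hψ₁ : IsPeriodicTest L ψ₁) (hψ₂ : IsPeriodicTest L ψ₂) :
    dirichletFormW L F φ (ψ₁ + ψ₂) = dirichletFormW L F φ ψ₁ + dirichletFormW L F φ ψ₂ := by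
  rw [dirichletFormW_comm, dirichletFormW_add_left hF hψ₁ hψ₂ hφ, dirichletFormW_comm L F ψ₁,
    dirichletFormW_comm L F ψ₂]

/-- `𝓔_F(φ₁ - φ₂, ψ) = 𝓔_F(φ₁, ψ) - 𝓔_F(φ₂, ψ)`. [folklore] -/
theorem dirichletFormW_sub_left (hF : Continuous F) (hφ₁ : IsPeriodicTest L φ₁)
    (hφ₂ : IsPeriodicTest L φ₂) (hψ : IsPeriodicTest L ψ) :
    dirichletFormW L F (φ₁ - φ₂) ψ = dirichletFormW L F φ₁ ψ - dirichletFormW L F φ₂ ψ := by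
  unfold dirichletFormW
  rw [← integral_sub (integrableOn_gradDot_mul_sq hF hφ₁.1 hψ.1 L)
    (integrableOn_gradDot_mul_sq hF hφ₂.1 hψ.1 L)]
  congr 1 with X
  rw [gradDot_sub_left (hφ₁.differentiable X) (hφ₂.differentiable X), sub_mul]

/-- **Polarisation of a sum**: `𝓔_F(φ + ψ, φ + ψ) = 𝓔_F(φ,φ) + 2𝓔_F(φ,ψ) + 𝓔_F(ψ,ψ)`. [folklore] -/
theorem dirichletFormW_add_add (hF : Continuous F) (hφ : IsPeriodicTest L φ)
    (hψ : IsPeriodicTest L ψ) :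
    dirichletFormW L F (φ + ψ) (φ + ψ) =
      dirichletFormW L F φ φ + 2 * dirichletFormW L F φ ψ + dirichletFormW L F ψ ψ := by
  rw [dirichletFormW_add_left hF hφ hψ (hφ.add hψ), dirichletFormW_add_right hF hφ hφ hψ,
    dirichletFormW_add_right hF hψ hφ hψ, dirichletFormW_comm L F ψ φ]
  ring

/-- The pairing integrand `g φ F²` is integrable on the cell for continuous data. [folklore] -/
theorem integrableOn_mul_mul_sq (hg : Continuous g) (hφ : Continuous φ) (hF : Continuous F)
    (L : ℝ) : IntegrableOn (fun X => g X * φ X * F X ^ 2) (cellN N L) volume :=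
  integrableOn_cellN ((hg.mul hφ).mul (hF.pow 2)) L

/-- Scaling of the pairing in the observable: `∫ (c g) φ F² = c ∫ g φ F²`. [folklore] -/
theorem integral_smul_mul_mul_sq (c L : ℝ) (F g φ : Config N → ℝ) :
    ∫ X in cellN N L, (c • g) X * φ X * F X ^ 2 = c * ∫ X in cellN N L, g X * φ X * F X ^ 2 := by
  rw [← integral_const_mul]
  congr 1 with X
  simp only [Pi.smul_apply, smul_eq_mul]
  ring

/-- Additivity of the pairing in the observable: `∫ (g₁ + g₂) φ F² = ∫ g₁ φ F² + ∫ g₂ φ F²`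
(continuous data). [folklore] -/
theorem integral_add_mul_mul_sq (hg₁ : Continuous g₁) (hg₂ : Continuous g₂) (hφ : Continuous φ)
    (hF : Continuous F) (L : ℝ) :
    ∫ X in cellN N L, (g₁ + g₂) X * φ X * F X ^ 2 =
      (∫ X in cellN N L, g₁ X * φ X * F X ^ 2) + ∫ X in cellN N L, g₂ X * φ X * F X ^ 2 := by
  rw [← integral_add (integrableOn_mul_mul_sq hg₁ hφ hF L) (integrableOn_mul_mul_sq hg₂ hφ hF L)]
  congr 1 with X
  simp only [Pi.add_apply]
  ring

/-- Additivity of the pairing in the test function: `∫ g (φ₁ + φ₂) F² = ∫ g φ₁ F² + ∫ g φ₂ F²`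
(continuous data). [folklore] -/
theorem integral_mul_add_mul_sq (hg : Continuous g) (hφ₁ : Continuous φ₁) (hφ₂ : Continuous φ₂)
    (hF : Continuous F) (L : ℝ) :
    ∫ X in cellN N L, g X * (φ₁ + φ₂) X * F X ^ 2 =
      (∫ X in cellN N L, g X * φ₁ X * F X ^ 2) + ∫ X in cellN N L, g X * φ₂ X * F X ^ 2 := by
  rw [← integral_add (integrableOn_mul_mul_sq hg hφ₁ hF L) (integrableOn_mul_mul_sq hg hφ₂ hF L)]
  congr 1 with X
  simp only [Pi.add_apply]
  ring

end Bilinear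

/-! ### Resolvent correctors -/

section Resolvent

variable {L m : ℝ} {F g g₁ g₂ χ χ₁ χ₂ : Config N → ℝ}

/-- **Resolvent (massive) corrector.** `χ` is a *resolvent corrector at mass `m`* of the
observable `g` for the weight `F` on the `N`-particle torus of side `L` if `χ` is a periodic test
function solving the resolvent equation `(m - L_F) χ = g`, `L_F = Δ + 2∇(log F)·∇`, in weak form
on the torus: `𝓔_F(χ, φ) + m ∫ χ φ F² dX = ∫ g φ F² dX` for every periodic test function `φ` —
Kipnis–Landim's resolvent equation `γ f_γ - L f_γ = g` (proof of their Prop. 6.1; Kipnis–Varadhan's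
`(λ - L) u_λ = V`) at `γ = m` for the `F² dX`-symmetric diffusion, tested on the `C¹` periodic
core as in `IsWeakCorrector`, which is the case `m = 0` (`isResolventCorrector_zero_iff`). For
`m = |p|²` this is the recoil-regularised corrector `χ = (-L_F + p²)⁻¹ g`. No existence statement
is made (see the module docstring); for `L > 0`, continuous non-vanishing `F` and `m > 0` the
corrector is unique (`IsResolventCorrector.unique`), and it satisfies Kipnis–Landim's estimates
(6.3), `m ∫ χ² F² ≤ ‖g‖²₋₁` and `𝓔_F(χ, χ) ≤ ‖g‖²₋₁`, indeed the identity
`‖g‖²₋₁ = m²‖χ‖²₋₁ + 2m ∫ χ² F² + 𝓔_F(χ, χ)` (`IsResolventCorrector.hMinusOneSqW_source_eq`).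
[cite: KipnisLandim1999, App. 1 §6, proof of Prop. 6.1 and (6.3)] -/
def IsResolventCorrector (L : ℝ) (F : Config N → ℝ) (m : ℝ) (g χ : Config N → ℝ) : Prop :=
  IsPeriodicTest L χ ∧
    ∀ φ : Config N → ℝ, IsPeriodicTest L φ →
      dirichletFormW L F χ φ + m * (∫ X in cellN N L, χ X * φ X * F X ^ 2) =
        ∫ X in cellN N L, g X * φ X * F X ^ 2

/-- Unfolding the definition. [folklore] -/
theorem isResolventCorrector_iff :
    IsResolventCorrector L F m g χ ↔
      IsPeriodicTest L χ ∧
        ∀ φ : Config N → ℝ, IsPeriodicTest L φ →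
          dirichletFormW L F χ φ + m * (∫ X in cellN N L, χ X * φ X * F X ^ 2) =
            ∫ X in cellN N L, g X * φ X * F X ^ 2 :=
  Iff.rfl

/-- **Mass zero is the corrector equation**: `IsResolventCorrector L F 0 g χ ↔ IsWeakCorrector L F g χ`
(`-L_F χ = g`). [cite: KipnisLandim1999, App. 1 §6, proof of Prop. 6.1] -/
theorem isResolventCorrector_zero_iff :
    IsResolventCorrector L F 0 g χ ↔ IsWeakCorrector L F g χ := by
  simp only [IsResolventCorrector, IsWeakCorrector, zero_mul, add_zero]

/-- **The resolvent equation is invariant under rescaling the weight** by a constant `c ≠ 0`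
(all three terms of `𝓔_{cF}(χ, φ) + m ∫ χ φ (cF)² = ∫ g φ (cF)²` carry the factor `c²`).
[folklore] -/
theorem isResolventCorrector_smul_weight_iff {c : ℝ} (hc : c ≠ 0) :
    IsResolventCorrector L (c • F) m g χ ↔ IsResolventCorrector L F m g χ := by
  simp only [IsResolventCorrector, dirichletFormW_smul_weight, integral_mul_mul_smul_sq]
  refine and_congr_right fun _ => forall₂_congr fun φ _ => ?_
  have key : ∀ E P : ℝ, c ^ 2 * E + m * (c ^ 2 * P) = c ^ 2 * (E + m * P) := fun E P => by ring
  rw [key]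
  exact (mul_right_injective₀ (pow_ne_zero 2 hc)).eq_iff

namespace IsResolventCorrector

/-- A resolvent corrector is a periodic test function. [folklore] -/
theorem isPeriodicTest (h : IsResolventCorrector L F m g χ) : IsPeriodicTest L χ := h.1

/-- The resolvent equation tested against `φ`: `𝓔_F(χ, φ) + m ∫ χ φ F² = ∫ g φ F²`. [folklore] -/
theorem eq (h : IsResolventCorrector L F m g χ) {φ : Config N → ℝ} (hφ : IsPeriodicTest L φ) :
    dirichletFormW L F χ φ + m * (∫ X in cellN N L, χ X * φ X * F X ^ 2) =
      ∫ X in cellN N L, g X * φ X * F X ^ 2 :=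
  h.2 φ hφ

/-- **Energy identity**: `𝓔_F(χ, χ) + m ∫ χ² F² = ∫ g χ F²` (test the equation against `χ`;
Kipnis–Landim: "taking the inner product with respect to `f_γ`"). [cite: KipnisLandim1999, App. 1 §6, proof of Prop. 6.1] -/
theorem energy (h : IsResolventCorrector L F m g χ) :
    dirichletFormW L F χ χ + m * (∫ X in cellN N L, χ X ^ 2 * F X ^ 2) =
      ∫ X in cellN N L, g X * χ X * F X ^ 2 := by
  have h1 := h.2 χ h.1
  have h2 : (fun X => χ X * χ X * F X ^ 2) = fun X => χ X ^ 2 * F X ^ 2 := funext fun X => by ring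
  rwa [h2] at h1

/-- **Centring**: `m ∫ χ F² = ∫ g F²` (test against `φ ≡ 1`, for which `𝓔_F(χ, 1) = 0`): the
resolvent divides the `F² dX`-mean by `m`, so for `m ≠ 0` the corrector `χ` is centred iff the
source `g` is. [folklore] -/
theorem integral_source (h : IsResolventCorrector L F m g χ) :
    m * (∫ X in cellN N L, χ X * F X ^ 2) = ∫ X in cellN N L, g X * F X ^ 2 := by
  have h1 := h.2 (fun _ => 1) (IsPeriodicTest.const L 1)
  rw [dirichletFormW_const_right, zero_add] at h1
  simpa using h1

/-- `0` is a resolvent corrector of `0`. [folklore] -/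
theorem zero (L : ℝ) (F : Config N → ℝ) (m : ℝ) : IsResolventCorrector L F m 0 0 :=
  ⟨IsPeriodicTest.zero L, fun φ _ => by
    have h := dirichletFormW_const_left L F φ 0
    simp only [Pi.zero_apply, zero_mul, integral_zero, mul_zero, add_zero]
    exact h⟩

/-- **Constants**: `χ ≡ c` is a resolvent corrector of `g ≡ m c` for every weight (constants are
`L_F`-harmonic, `(m - L_F) c = m c`). [folklore] -/
theorem const (L : ℝ) (F : Config N → ℝ) (m c : ℝ) :
    IsResolventCorrector L F m (fun _ => m * c) (fun _ => c) :=
  ⟨IsPeriodicTest.const L c, fun φ _ => by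
    rw [dirichletFormW_const_left, zero_add, ← integral_const_mul]
    congr 1 with X
    ring⟩

/-- Linearity: `c χ` is a resolvent corrector of `c g`. [folklore] -/
theorem smul (c : ℝ) (h : IsResolventCorrector L F m g χ) :
    IsResolventCorrector L F m (c • g) (c • χ) := by
  refine ⟨h.1.smul c, fun φ hφ => ?_⟩
  rw [dirichletFormW_smul_left, integral_smul_mul_mul_sq, integral_smul_mul_mul_sq, ← h.2 φ hφ]
  ring

/-- Linearity: `-χ` is a resolvent corrector of `-g`. [folklore] -/
theorem neg (h : IsResolventCorrector L F m g χ) : IsResolventCorrector L F m (-g) (-χ) := by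
  simpa using h.smul (-1)

/-- Linearity: a sum of resolvent correctors is a resolvent corrector of the sum of the sources
(continuous weight and sources, for the integrals to split). [folklore] -/
theorem add (hF : Continuous F) (hg₁ : Continuous g₁) (hg₂ : Continuous g₂)
    (h₁ : IsResolventCorrector L F m g₁ χ₁) (h₂ : IsResolventCorrector L F m g₂ χ₂) :
    IsResolventCorrector L F m (g₁ + g₂) (χ₁ + χ₂) := by
  refine ⟨h₁.1.add h₂.1, fun φ hφ => ?_⟩
  rw [dirichletFormW_add_left hF h₁.1 h₂.1 hφ,
    integral_add_mul_mul_sq h₁.1.continuous h₂.1.continuous hφ.continuous hF,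
    integral_add_mul_mul_sq hg₁ hg₂ hφ.continuous hF, ← h₁.2 φ hφ, ← h₂.2 φ hφ]
  ring

/-- Linearity: a difference of resolvent correctors is a resolvent corrector of the difference of
the sources (continuous weight and sources). [folklore] -/
theorem sub (hF : Continuous F) (hg₁ : Continuous g₁) (hg₂ : Continuous g₂)
    (h₁ : IsResolventCorrector L F m g₁ χ₁) (h₂ : IsResolventCorrector L F m g₂ χ₂) :
    IsResolventCorrector L F m (g₁ - g₂) (χ₁ - χ₂) := by
  simpa [sub_eq_add_neg] using h₁.add hF hg₁ hg₂.neg h₂.neg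

/-- **The resolvent equation as a corrector equation**: `χ` is a weak corrector of `g - m χ`
(`-L_F χ = g - m χ`; continuous weight and source, for the pairing to split). In particular
`‖g - m χ‖²₋₁ = 𝓔_F(χ, χ)` (`hMinusOneSqW_source_sub_eq`). [cite: KipnisLandim1999, App. 1 §6, proof of Prop. 6.1] -/
theorem isWeakCorrector_sub (hF : Continuous F) (hg : Continuous g)
    (h : IsResolventCorrector L F m g χ) : IsWeakCorrector L F (g - m • χ) χ := by
  refine ⟨h.1, fun φ hφ => ?_⟩
  have hsplit : ∫ X in cellN N L, (g - m • χ) X * φ X * F X ^ 2 =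
      (∫ X in cellN N L, g X * φ X * F X ^ 2) - ∫ X in cellN N L, (m • χ) X * φ X * F X ^ 2 := by
    rw [← integral_sub (integrableOn_mul_mul_sq hg hφ.continuous hF L)
      (integrableOn_mul_mul_sq (h.1.smul m).continuous hφ.continuous hF L)]
    congr 1 with X
    simp only [Pi.sub_apply]
    ring
  rw [hsplit, integral_smul_mul_mul_sq, ← h.2 φ hφ]
  ring

/-- `‖g - m χ‖²₋₁ = 𝓔_F(χ, χ)` (`= ‖f_γ‖₁²`: Kipnis–Landim's `‖S f‖²₋₁ = ‖f‖₁²` for `S f = g - γ f`).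
[cite: KipnisLandim1999, App. 1 §6] -/
theorem hMinusOneSqW_source_sub_eq (hF : Continuous F) (hg : Continuous g)
    (h : IsResolventCorrector L F m g χ) :
    hMinusOneSqW L F (g - m • χ) = ENNReal.ofReal (dirichletFormW L F χ χ) := by
  have hw := h.isWeakCorrector_sub hF hg
  rw [hw.hMinusOneSqW_eq hF, ← hw.dirichletFormW_self]

/-- **Uniqueness of resolvent correctors.** For `L > 0`, a continuous non-vanishing weight `F` and
`m > 0`, two resolvent correctors of the same source coincide (everywhere on `(ℝ³)^N`): the
difference `δ` solves the homogeneous equation, testing it against `δ` gives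
`𝓔_F(δ, δ) + m ∫ δ² F² = 0`, so `δ F = 0` a.e. on the cell, hence `δ = 0` a.e. on the cell, a.e.
on `(ℝ³)^N` by periodicity (`ae_eq_of_periodic_of_ae_eq_cellN`), and everywhere by continuity.
(For `m = 0` correctors are only unique up to constants; for `L ≤ 0` the cell is empty.)
[folklore] -/
theorem unique (hL : 0 < L) (hF : Continuous F) (hF0 : ∀ X, F X ≠ 0) (hm : 0 < m)
    (h₁ : IsResolventCorrector L F m g χ₁) (h₂ : IsResolventCorrector L F m g χ₂) : χ₁ = χ₂ := by
  have hδ : IsPeriodicTest L (χ₁ - χ₂) := h₁.1.sub h₂.1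
  have hint : ∀ {u w : Config N → ℝ}, Continuous u → Continuous w →
      IntegrableOn (fun X => u X * w X * F X ^ 2) (cellN N L) volume := fun hu hw =>
    integrableOn_mul_mul_sq hu hw hF L
  -- the homogeneous equation tested against `δ = χ₁ - χ₂`
  have hhom : dirichletFormW L F (χ₁ - χ₂) (χ₁ - χ₂) +
      m * ∫ X in cellN N L, (χ₁ - χ₂) X * (χ₁ - χ₂) X * F X ^ 2 = 0 := by
    have e₁ := h₁.2 _ hδ
    have e₂ := h₂.2 _ hδ
    have hsplit : ∫ X in cellN N L, (χ₁ - χ₂) X * (χ₁ - χ₂) X * F X ^ 2 =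
        (∫ X in cellN N L, χ₁ X * (χ₁ - χ₂) X * F X ^ 2) -
          ∫ X in cellN N L, χ₂ X * (χ₁ - χ₂) X * F X ^ 2 := by
      rw [← integral_sub (hint h₁.1.continuous hδ.continuous) (hint h₂.1.continuous hδ.continuous)]
      congr 1 with X
      simp only [Pi.sub_apply]
      ring
    rw [dirichletFormW_sub_left hF h₁.1 h₂.1 hδ, hsplit]
    linarith
  -- hence `∫ δ² F² = 0` on the cell
  have hE := dirichletFormW_self_nonneg L F (χ₁ - χ₂)
  have hI : 0 ≤ ∫ X in cellN N L, (χ₁ - χ₂) X * (χ₁ - χ₂) X * F X ^ 2 :=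
    integral_nonneg fun X => mul_nonneg (mul_self_nonneg _) (sq_nonneg _)
  have hI0 : ∫ X in cellN N L, (χ₁ - χ₂) X * (χ₁ - χ₂) X * F X ^ 2 = 0 :=
    le_antisymm (by nlinarith [mul_nonneg hm.le hI]) hI
  -- so `δ² F² = 0` a.e. on the cell, i.e. `δ = 0` a.e. on the cell (`F ≠ 0`)
  have hae : (fun X => (χ₁ - χ₂) X * (χ₁ - χ₂) X * F X ^ 2) =ᵐ[volume.restrict (cellN N L)] 0 :=
    (integral_eq_zero_iff_of_nonneg (fun X => mul_nonneg (mul_self_nonneg _) (sq_nonneg _))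
      (hint hδ.continuous hδ.continuous)).1 hI0
  have hae' : (χ₁ - χ₂) =ᵐ[volume.restrict (cellN N L)] (0 : Config N → ℝ) := by
    filter_upwards [hae] with X hX
    rcases mul_eq_zero.1 hX with h | h
    · exact mul_self_eq_zero.1 h
    · exact absurd ((pow_eq_zero_iff two_ne_zero).1 h) (hF0 X)
  -- periodicity spreads this over `(ℝ³)^N`, continuity makes it hold everywhere
  have hper := ae_eq_of_periodic_of_ae_eq_cellN hL hδ.2 (g' := (0 : Config N → ℝ))
    (fun _ _ _ => rfl) hae'
  exact sub_eq_zero.1 (Measure.eq_of_ae_eq hper hδ.continuous continuous_const)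

/-! #### The `H₋₁` identity and the resolvent estimates -/

/-- **The `H₋₁` functional of the source along `m φ + χ`.** For a resolvent corrector `χ` of `g`
at mass `m` and every periodic test function `φ`,
`2 ∫ g (mφ + χ) F² - 𝓔_F(mφ + χ, mφ + χ) = m² (2 ∫ χ φ F² - 𝓔_F(φ, φ)) + (2m ∫ χ² F² + 𝓔_F(χ, χ))`:
substitute `∫ g ψ F² = 𝓔_F(χ, ψ) + m ∫ χ ψ F²` and expand; the cross terms `± 2m 𝓔_F(χ, φ)`
cancel. [folklore] -/
theorem hMinusOne_term_eq (hF : Continuous F) (h : IsResolventCorrector L F m g χ)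
    {φ : Config N → ℝ} (hφ : IsPeriodicTest L φ) :
    2 * (∫ X in cellN N L, g X * (m • φ + χ) X * F X ^ 2) -
        dirichletFormW L F (m • φ + χ) (m • φ + χ) =
      m ^ 2 * (2 * (∫ X in cellN N L, χ X * φ X * F X ^ 2) - dirichletFormW L F φ φ) +
        (2 * m * (∫ X in cellN N L, χ X ^ 2 * F X ^ 2) + dirichletFormW L F χ χ) := by
  have hχ := h.1
  have hmφ : IsPeriodicTest L (m • φ) := hφ.smul m
  -- the equation tested against `ψ = m φ + χ`, then bilinear expansion
  rw [← h.2 _ (hmφ.add hχ), dirichletFormW_add_right hF hχ hmφ hχ, dirichletFormW_smul_right,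
    dirichletFormW_add_add hF hmφ hχ, dirichletFormW_smul_left, dirichletFormW_smul_right,
    dirichletFormW_smul_left, dirichletFormW_comm L F φ χ]
  have hp : ∫ X in cellN N L, χ X * (m • φ + χ) X * F X ^ 2 =
      m * (∫ X in cellN N L, χ X * φ X * F X ^ 2) + ∫ X in cellN N L, χ X ^ 2 * F X ^ 2 := by
    rw [← integral_const_mul, ← integral_add
      ((integrableOn_mul_mul_sq hχ.continuous hφ.continuous hF L).const_mul m)
      (integrableOn_cellN (f := fun X => χ X ^ 2 * F X ^ 2)
        ((hχ.continuous.pow 2).mul (hF.pow 2)) L)]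
    congr 1 with X
    simp only [Pi.add_apply, Pi.smul_apply, smul_eq_mul]
    ring
  rw [hp]
  ring

/-- **The `H₋₁` identity for the resolvent.** For a continuous weight, `m > 0` and a resolvent
corrector `χ` of `g` at mass `m`:
`‖g‖²₋₁ = m² ‖χ‖²₋₁ + 2m ∫ χ² F² dX + 𝓔_F(χ, χ)` in `[0, ∞]` — the `m > 0` companion of
Kipnis–Landim's `‖S f‖²₋₁ = ‖f‖₁²` (spectrally, with `A = -L_F ≥ 0` and `g = (m + A)χ`:
`⟨g, A⁻¹ g⟩ = m²⟨χ, A⁻¹χ⟩ + 2m⟨χ, χ⟩ + ⟨χ, Aχ⟩`). Proof on the core: by `hMinusOne_term_eq` the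
`H₋₁` functional of `g` at `mφ + χ` is `m²` times that of `χ` at `φ` plus the constant, and
`φ ↦ mφ + χ` is a bijection of the periodic test functions. In particular `‖g‖²₋₁ < ∞` iff
`‖χ‖²₋₁ < ∞`. [cite: KipnisLandim1999, App. 1 §6, (6.1)–(6.3)] -/
theorem hMinusOneSqW_source_eq (hF : Continuous F) (hm : 0 < m)
    (h : IsResolventCorrector L F m g χ) :
    hMinusOneSqW L F g =
      ENNReal.ofReal (m ^ 2) * hMinusOneSqW L F χ +
        ENNReal.ofReal (2 * m * (∫ X in cellN N L, χ X ^ 2 * F X ^ 2) + dirichletFormW L F χ χ) := by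
  have hc0 : 0 ≤ 2 * m * (∫ X in cellN N L, χ X ^ 2 * F X ^ 2) + dirichletFormW L F χ χ :=
    add_nonneg (mul_nonneg (mul_nonneg zero_le_two hm.le)
      (integral_nonneg fun X => mul_nonneg (sq_nonneg _) (sq_nonneg _)))
      (dirichletFormW_self_nonneg L F χ)
  refine le_antisymm ?_ ?_
  · -- `≤`: every test `ψ` is `m φ + χ` with `φ = m⁻¹ (ψ - χ)`
    rw [hMinusOneSqW]
    refine iSup₂_le fun ψ hψ => ?_
    have hφ : IsPeriodicTest L (m⁻¹ • (ψ - χ)) := (hψ.sub h.1).smul m⁻¹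
    have hψφ : m • (m⁻¹ • (ψ - χ)) + χ = ψ := by
      rw [smul_smul, mul_inv_cancel₀ hm.ne', one_smul, sub_add_cancel]
    have hk := h.hMinusOne_term_eq hF hφ
    rw [hψφ] at hk
    rw [hk]
    calc ENNReal.ofReal (m ^ 2 * (2 * (∫ X in cellN N L, χ X * (m⁻¹ • (ψ - χ)) X * F X ^ 2) -
            dirichletFormW L F (m⁻¹ • (ψ - χ)) (m⁻¹ • (ψ - χ))) +
          (2 * m * (∫ X in cellN N L, χ X ^ 2 * F X ^ 2) + dirichletFormW L F χ χ))
        ≤ ENNReal.ofReal (m ^ 2 * (2 * (∫ X in cellN N L, χ X * (m⁻¹ • (ψ - χ)) X * F X ^ 2) -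
            dirichletFormW L F (m⁻¹ • (ψ - χ)) (m⁻¹ • (ψ - χ)))) +
          ENNReal.ofReal (2 * m * (∫ X in cellN N L, χ X ^ 2 * F X ^ 2) + dirichletFormW L F χ χ) :=
          ENNReal.ofReal_add_le
      _ = ENNReal.ofReal (m ^ 2) *
            ENNReal.ofReal (2 * (∫ X in cellN N L, χ X * (m⁻¹ • (ψ - χ)) X * F X ^ 2) -
              dirichletFormW L F (m⁻¹ • (ψ - χ)) (m⁻¹ • (ψ - χ))) +
          ENNReal.ofReal (2 * m * (∫ X in cellN N L, χ X ^ 2 * F X ^ 2) + dirichletFormW L F χ χ) := by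
          rw [ENNReal.ofReal_mul (sq_nonneg m)]
      _ ≤ ENNReal.ofReal (m ^ 2) * hMinusOneSqW L F χ +
          ENNReal.ofReal (2 * m * (∫ X in cellN N L, χ X ^ 2 * F X ^ 2) + dirichletFormW L F χ χ) := by
          gcongr
          exact le_hMinusOneSqW L F χ hφ
  · -- `≥`: the value of the functional of `g` at `m φ + χ` (resp. at `χ`) dominates each term
    have hne : ∃ φ : Config N → ℝ, IsPeriodicTest L φ := ⟨0, IsPeriodicTest.zero L⟩
    rw [hMinusOneSqW, ENNReal.mul_iSup]
    simp_rw [ENNReal.mul_iSup]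
    rw [ENNReal.biSup_add' hne]
    refine iSup₂_le fun φ hφ => ?_
    rcases le_or_gt 0 (2 * (∫ X in cellN N L, χ X * φ X * F X ^ 2) - dirichletFormW L F φ φ)
      with hT | hT
    · rw [← ENNReal.ofReal_mul (sq_nonneg m), ← ENNReal.ofReal_add (mul_nonneg (sq_nonneg m) hT) hc0,
        ← h.hMinusOne_term_eq hF hφ]
      exact le_hMinusOneSqW L F g ((hφ.smul m).add h.1)
    · rw [ENNReal.ofReal_of_nonpos hT.le, mul_zero, zero_add]
      have hval : 2 * (∫ X in cellN N L, g X * χ X * F X ^ 2) - dirichletFormW L F χ χ =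
          2 * m * (∫ X in cellN N L, χ X ^ 2 * F X ^ 2) + dirichletFormW L F χ χ := by
        rw [← h.energy]
        ring
      rw [← hval]
      exact le_hMinusOneSqW L F g h.1

/-- `m² ‖χ‖²₋₁ ≤ ‖g‖²₋₁`. [cite: KipnisLandim1999, App. 1 §6, (6.3)] -/
theorem ofReal_sq_mul_hMinusOneSqW_le (hF : Continuous F) (hm : 0 < m)
    (h : IsResolventCorrector L F m g χ) :
    ENNReal.ofReal (m ^ 2) * hMinusOneSqW L F χ ≤ hMinusOneSqW L F g := by
  rw [h.hMinusOneSqW_source_eq hF hm]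
  exact le_self_add

/-- **Resolvent contraction in `H₋₁`**: `‖χ‖²₋₁ ≤ m⁻² ‖g‖²₋₁` for `χ = (m - L_F)⁻¹ g`, `m > 0`
(spectrally `∫ dμ_g(ω) / (ω (ω + m)²) ≤ m⁻² ∫ dμ_g(ω) / ω`). [cite: KipnisLandim1999, App. 1 §6, (6.3)] -/
theorem hMinusOneSqW_le (hF : Continuous F) (hm : 0 < m) (h : IsResolventCorrector L F m g χ) :
    hMinusOneSqW L F χ ≤ ENNReal.ofReal (m⁻¹ ^ 2) * hMinusOneSqW L F g := by
  calc hMinusOneSqW L F χ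
      = ENNReal.ofReal (m⁻¹ ^ 2) * (ENNReal.ofReal (m ^ 2) * hMinusOneSqW L F χ) := by
        rw [← mul_assoc, ← ENNReal.ofReal_mul (sq_nonneg _), ← mul_pow, inv_mul_cancel₀ hm.ne',
          one_pow, ENNReal.ofReal_one, one_mul]
    _ ≤ ENNReal.ofReal (m⁻¹ ^ 2) * hMinusOneSqW L F g := by
        gcongr
        exact h.ofReal_sq_mul_hMinusOneSqW_le hF hm

/-- With `g ∈ H₋₁` the resolvent corrector is in `H₋₁`. [folklore] -/
theorem hMinusOneSqW_ne_top (hF : Continuous F) (hm : 0 < m) (h : IsResolventCorrector L F m g χ)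
    (hg : hMinusOneSqW L F g ≠ ⊤) : hMinusOneSqW L F χ ≠ ⊤ :=
  ne_top_of_le_ne_top (ENNReal.mul_ne_top ENNReal.ofReal_ne_top hg) (h.hMinusOneSqW_le hF hm)

/-- Conversely, a source with a resolvent corrector in `H₋₁` is in `H₋₁` (so `‖g‖²₋₁ < ∞` iff
`‖χ‖²₋₁ < ∞`). [folklore] -/
theorem hMinusOneSqW_source_ne_top (hF : Continuous F) (hm : 0 < m)
    (h : IsResolventCorrector L F m g χ) (hχ : hMinusOneSqW L F χ ≠ ⊤) :
    hMinusOneSqW L F g ≠ ⊤ := by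
  rw [h.hMinusOneSqW_source_eq hF hm]
  exact ENNReal.add_ne_top.2 ⟨ENNReal.mul_ne_top ENNReal.ofReal_ne_top hχ, ENNReal.ofReal_ne_top⟩

/-- **Kipnis–Landim (6.3), the `H₁` estimate**: `‖f_γ‖₁² = 𝓔_F(χ, χ) ≤ ‖g‖²₋₁`.
[cite: KipnisLandim1999, App. 1 §6, (6.3)] -/
theorem ofReal_dirichletFormW_self_le (hF : Continuous F) (hm : 0 < m)
    (h : IsResolventCorrector L F m g χ) :
    ENNReal.ofReal (dirichletFormW L F χ χ) ≤ hMinusOneSqW L F g := by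
  rw [h.hMinusOneSqW_source_eq hF hm]
  refine le_add_left (ENNReal.ofReal_le_ofReal (le_add_of_nonneg_left ?_))
  exact mul_nonneg (mul_nonneg zero_le_two hm.le)
    (integral_nonneg fun X => mul_nonneg (sq_nonneg _) (sq_nonneg _))

/-- **Kipnis–Landim (6.3), the `L²` estimate** (sharpened by the factor `2` available in the
reversible case): `2m ∫ χ² F² ≤ ‖g‖²₋₁` (printed: `γ⟨f_γ, f_γ⟩_π ≤ ‖g‖²₋₁`).
[cite: KipnisLandim1999, App. 1 §6, (6.3)] -/
theorem ofReal_integral_sq_le (hF : Continuous F) (hm : 0 < m)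
    (h : IsResolventCorrector L F m g χ) :
    ENNReal.ofReal (2 * m * ∫ X in cellN N L, χ X ^ 2 * F X ^ 2) ≤ hMinusOneSqW L F g := by
  rw [h.hMinusOneSqW_source_eq hF hm]
  exact le_add_left (ENNReal.ofReal_le_ofReal
    (le_add_of_nonneg_right (dirichletFormW_self_nonneg L F χ)))

/-- Real form of the `H₁` estimate under a bound `‖g‖²₋₁ ≤ C`: `𝓔_F(χ, χ) ≤ C`. [cite: KipnisLandim1999, App. 1 §6, (6.3)] -/
theorem dirichletFormW_self_le (hF : Continuous F) (hm : 0 < m) (h : IsResolventCorrector L F m g χ)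
    {C : ℝ} (hC : 0 ≤ C) (hg : hMinusOneSqW L F g ≤ ENNReal.ofReal C) :
    dirichletFormW L F χ χ ≤ C :=
  (ENNReal.ofReal_le_ofReal_iff hC).1 ((h.ofReal_dirichletFormW_self_le hF hm).trans hg)

/-- Real form of the `L²` estimate under a bound `‖g‖²₋₁ ≤ C`: `2m ∫ χ² F² ≤ C`. [cite: KipnisLandim1999, App. 1 §6, (6.3)] -/
theorem integral_sq_le (hF : Continuous F) (hm : 0 < m) (h : IsResolventCorrector L F m g χ)
    {C : ℝ} (hC : 0 ≤ C) (hg : hMinusOneSqW L F g ≤ ENNReal.ofReal C) :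
    2 * m * (∫ X in cellN N L, χ X ^ 2 * F X ^ 2) ≤ C :=
  (ENNReal.ofReal_le_ofReal_iff hC).1 ((h.ofReal_integral_sq_le hF hm).trans hg)

/-- Real form of the resolvent contraction under a bound `‖g‖²₋₁ ≤ C`: the Kipnis–Varadhan bound
`(∫ χ φ F² dX)² ≤ (C / m²) 𝓔_F(φ, φ)` for every periodic test function `φ`
(`hMinusOneSqW_le_ofReal_iff`). [cite: KipnisVaradhan1986, (1.14)] -/
theorem sq_integral_le (hF : Continuous F) (hm : 0 < m) (h : IsResolventCorrector L F m g χ)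
    {C : ℝ} (hC : 0 ≤ C) (hg : hMinusOneSqW L F g ≤ ENNReal.ofReal C) {φ : Config N → ℝ}
    (hφ : IsPeriodicTest L φ) :
    (∫ X in cellN N L, χ X * φ X * F X ^ 2) ^ 2 ≤ C / m ^ 2 * dirichletFormW L F φ φ := by
  have h1 : hMinusOneSqW L F χ ≤ ENNReal.ofReal (C / m ^ 2) := by
    calc hMinusOneSqW L F χ ≤ ENNReal.ofReal (m⁻¹ ^ 2) * hMinusOneSqW L F g := h.hMinusOneSqW_le hF hm
      _ ≤ ENNReal.ofReal (m⁻¹ ^ 2) * ENNReal.ofReal C := by gcongr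
      _ = ENNReal.ofReal (C / m ^ 2) := by
          rw [← ENNReal.ofReal_mul (sq_nonneg _), inv_pow, div_eq_inv_mul]
  exact (hMinusOneSqW_le_ofReal_iff (by positivity)).1 h1 φ hφ

/-! #### Classical solutions (the strong form `-L_F χ + m χ = g` of `LangevinGenerator.lean`) -/

/-- **Classical solutions are resolvent correctors.** For `L > 0`, a `C¹` lattice-periodic
non-vanishing weight `F` and a `C²` lattice-periodic `χ` solving `-L_F χ + m χ = g` pointwise
(`L_F = langevinGen F = Δ + 2∇(log F)·∇`), `χ` is a resolvent corrector of `g` at mass `m`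
(Green's identity `∫ φ (L_F χ) F² = -𝓔_F(φ, χ)`, `integral_mul_langevinGen_mul_sq`).
[cite: BakryGentilLedoux2014, §1.11.3 (1.11.9)] -/
theorem of_langevinGen (hL : 0 < L) (hF : ContDiff ℝ 1 F) (hFper : IsLatticePeriodic L F)
    (h0 : ∀ X, F X ≠ 0) (hχ : ContDiff ℝ 2 χ) (hχper : IsLatticePeriodic L χ)
    (hg : ∀ X, -langevinGen F χ X + m * χ X = g X) : IsResolventCorrector L F m g χ := by
  -- `χ` is a weak corrector of `g - m χ = -L_F χ`
  have hw : IsWeakCorrector L F (fun X => g X - m * χ X) χ :=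
    IsWeakCorrector.of_langevinGen hL hF hFper h0 hχ hχper fun X => by linarith [hg X]
  have hχc : Continuous χ := hχ.continuous
  have hgc : Continuous g := by
    have hg' : g = fun X => -langevinGen F χ X + m * χ X := funext fun X => (hg X).symm
    rw [hg']
    exact (continuous_langevinGen hF h0 hχ).neg.add (continuous_const.mul hχc)
  refine ⟨hw.isPeriodicTest, fun φ hφ => ?_⟩
  rw [hw.dirichletFormW_eq hφ, ← integral_const_mul, ← integral_add
    (integrableOn_mul_mul_sq (g := fun X => g X - m * χ X) (hgc.sub (continuous_const.mul hχc))
      hφ.continuous hF.continuous L)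
    ((integrableOn_mul_mul_sq hχc hφ.continuous hF.continuous L).const_mul m)]
  congr 1 with X
  ring

/-- **Resolvent correctors with smooth data are classical solutions**: for `L > 0`, `F ∈ C²`
lattice periodic and non-vanishing, `χ ∈ C³` and `g ∈ C¹` lattice periodic, a resolvent corrector
satisfies `-L_F χ + m χ = g` everywhere on `(ℝ³)^N` (`IsWeakCorrector.neg_langevinGen_eq` for the
source `g - m χ` on the fundamental cell, transported by the lattice reduction `cellProj`, all three
terms being lattice periodic). [folklore] -/
theorem neg_langevinGen_add_eq (h : IsResolventCorrector L F m g χ) (hL : 0 < L)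
    (hF : ContDiff ℝ 2 F) (hFper : IsLatticePeriodic L F) (h0 : ∀ X, F X ≠ 0)
    (hχ : ContDiff ℝ 3 χ) (hg : ContDiff ℝ 1 g) (hgper : IsLatticePeriodic L g) (X : Config N) :
    -langevinGen F χ X + m * χ X = g X := by
  have hχper : IsLatticePeriodic L χ := h.isPeriodicTest.isLatticePeriodic
  have hw : IsWeakCorrector L F (g - m • χ) χ := h.isWeakCorrector_sub hF.continuous hg.continuous
  have hsper : IsLatticePeriodic L (g - m • χ) := fun Y i k => by
    simp only [Pi.sub_apply, Pi.smul_apply, smul_eq_mul, hgper Y i k, hχper Y i k]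
  -- on the fundamental cell
  have hcell : ∀ Y ∈ cellN N L, -langevinGen F χ Y + m * χ Y = g Y := fun Y hY => by
    have e := hw.neg_langevinGen_eq hL hF hFper h0 hχ
      (hg.sub (contDiff_const.mul (hχ.of_le (by norm_num)))) hsper hY
    simp only [Pi.sub_apply, Pi.smul_apply, smul_eq_mul] at e
    linarith
  -- everywhere, by lattice reduction of the three periodic terms
  have e := hcell (cellProj L X) (cellProj_mem_cellN hL X)
  rwa [apply_cellProj_of_periodic (hFper.langevinGen hχper), apply_cellProj_of_periodic hχper,
    apply_cellProj_of_periodic hgper] at e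

end IsResolventCorrector

end Resolvent

end Literature.MathematicalPhysics.QuantumManyBody.BoseGas
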